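import Summits.QuantumFields.YangMills.Theorems.BalabanUVNodesN22W1RelCentredSliceInputsL2U
import Summits.QuantumFields.YangMills.Theorems.BalabanUVNodesN22W1RelCentredKernelBlockOfWalkRecord
import Summits.QuantumFields.YangMills.Theorems.BalabanUVNodesN22W1RelCentredOlderLemma2OfReadingC
import Summits.QuantumFields.YangMills.Theorems.BalabanUVNodesN22W1PrintedBoxBlockAtDatum
import Summits.QuantumFields.YangMills.Theorems.BalabanUVNodesN22W1RelCentredWilsonLemma2OfActionReading

/-!
# BalabanUVNodes ∕ node N22 = NE9 — THE RELATIVE-DISC CENTRED ROAD OVER THE ADMISSIBLE CLASS, MODULE J23: THE LOCATED RECORD OF ONE SLICE ASSEMBLED FROM THE LANDED BLOCK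
# PRODUCERS' INPUTS — `SliceInputsL2U` (J17-D) at the real slices of complex potentials FROM: NODE A's walk record at the slice (module J16's inputs), ONE complex reading of the older
# terms (module J20's inputs), print's boxes on the term's row bonds (dag-n22-w1's at-datum inputs), ONE analytic localized action reading whose third-order remainder is the Wilson
# remainder (dag-n22-w3's J22 inputs on node00-def-W1's W1-17d), and the residual located inputs (σ-holomorphy, fibre count, `C⁻¹` letter, tail ∕ window letters, mixed numerals,
# closures, profile) — the record's free letters PINNED INSIDE THE PROOF

Cell `pub-ymgap`, HUMAN RULING D-0062 (Track A), R134 ACCELERATION re-seat `pub-ymgap-dag-n22-c` (strategy s1), generation 11, file J23.  THEOREMS ONLY; imports J17-D `…SliceInputsL2U` (the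
record), J16 `…KernelBlockOfWalkRecord` (`SliceInputsLGU.kernelLaws_of_termWalkData`), J20 `…OlderLemma2OfReadingC` (`SliceInputsL2U.olderBlock_of_readsOnByC`), dag-n22-w1's
`…N22W1PrintedBoxBlockAtDatum` (`N22PrintedBoxBlock.unscaledBoxLaws_of_printedBoxes ∕ h222_atDatum ∕ hqP_atDatum ∕ hχ1_atDatum ∕ hboxR_atDatum ∕ hbox_atDatum`) and dag-n22-w3's J22
`…N22W1RelCentredWilsonLemma2OfActionReading` (`SliceInputsL2U.wilsonBlock_of_wilsonOfActionOn`) BY NAME.  `--supports` K3⁷ `SpineGivenEndpointR13SepCoPH` (stmt-QuantumFields-20544)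
as a helper.

WHY.  The knit of record (J17-K `n22At_u3OfRecord₁₃_ofRecordAdm_runTowers_toClusterTower_of_n18Below_unscaledLawDatumL2U`, its K3⁷-facing storey J19) asks ONE `SliceInputsL2U` record per
slice `(Z, t)`, table `X` and base point `s₀` — a list of 168 located letters and laws.  Four of its blocks now have LANDED PRODUCER THEOREMS reading them off OBJECTS: the kernel block off
NODE A's walk record `TermWalkData` (J16), the older-terms block off one complex reading `ReadingAtomsC` (J20, node00-def-W1 W1-17c), the box block off print's characteristic functions
(dag-n22-w1 p584099 ∕ p585490), and the Wilson block off ONE analytic localized action reading `LocActionC` whose third-order remainder is the Wilson remainder (dag-n22-w3's J22 p587317 on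
node00-def-W1's W1-17d p586823).  THIS FILE assembles the record from those producers'
INPUTS in one theorem, so that a prover of the located tuple applies ONE declaration per slice, and so that the theorem's hypothesis list IS the residual census of node N22's located
inputs in producer currency: (K) a walk record with an admissible package, the reading map holomorphic into the `α`-ball, symmetry and `Re ≻ 0` of the precision on the closed
`e^{κ₁+1}`-polydisc, three rates, letters dominating the package's; (O) σ-holomorphy of the kernels on the open polydisc (NODE O), the fibre count of the site locations, the `C⁻¹`
letter; (B) print's boxes `χᵘ = Π_{Y₀} χ(|A(b)| < ε₁)`, `χᶜᵘ = Π_P χ(ε₁ ≤ |A(b)|)` with node00-def-B13's count pin `|Pl| = |P(t)|`, the (2.22) letter `γ₂`, the tail ∕ window letters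
`T, TP, κ, r₁` against the knit's `a, Mv` at print's forced threshold `rP = Rb = ε₁∕s₀` (dag-n22-w1 ∕ w2's window numerals, displayed, not resolved here); (W) ONE analytic localized
action `𝒜 : LocActionC` whose third-order remainder on `W × 𝔅c` IS the complex Wilson remainder `Wc` (`WilsonOfActionOn`), `𝔅c` open `⊇ ball 0 RA ∋` the box and every real field, joint
analyticity, a sup letter `M𝒜` with `M𝒲 ≥ 8·M𝒜`, real-slice measurability, locality through supports `S Y ⊆ Y0l` located in `Y` (J22's inputs verbatim), the (2.19) profile at the
τ-radii; (L) ONE complex reading `Ra` of the older terms read on the admissible class, the thickening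
and every complex field with its seven laws (J20 §2 verbatim), a letter `M𝒪 ≥ crudeBound`; (N) the mixed numerals and the closures VERBATIM; (T) W1-8's `0 < invTau c d ≤ ½`, the datum's
Cauchy radius `0 < r ≤ e^{κ₁} − 1`, τ-radii `R Y ≥ τ(Y)⁻¹ + r + 2` on `𝐃`.  PINNED INSIDE THE PROOF (the record is existential; any lawful choice serves): `Uσ := ball 0 e^{c.κ₁+1}` (J16's),
`Uτ Y := ball 0 (τ(Y)⁻¹ + r + 2)`, `kap := κb`, `qP B := Σ_{b∈Pl} B(b)²`, `rP := Rb := ε₁∕s₀`, `ρ := ε₁`, `S₀ := Y0l Z t`, `𝒲 := realSliceWilson Wc`, `𝒪 := realSliceOlder Oc`; DERIVED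
inside: `hpos hhalf hUσ hUτ hUexp hUtau hsubτ hR hUτR`, the six box laws at the base point + `h222 hqP hχ1 hboxR hbox hρ`, the eleven kernel laws (J16, relettered) + the seven letter signs,
the three unprimed θ-dominations (monotonicity in `ρ_b ∈ [0,1[`), the eight Wilson fields (J22, relettered), the eight older-terms fields (J20, relettered), `hSS₀` — 68 of the record's
168 fields.

HONEST FRAMING — what this is NOT.  Count-neutral consumer-side assembly BY NAME of LANDED theorems; NO estimate of Bałaban's is proved here; every hypothesis is a located input whose
inhabitant at the datum of record is another lane's (NODE A ∕ NODE O: the walk record, σ-holomorphy, the analytic action of record with its laws; def-B13 ∕ N09: the boxes' bond sets and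
count pin; def-W1 ∕ N10: the complex reading; the window numerals of (B) are dag-n22-w1 ∕ w2's located points
«WINDOW-N22-J» — VALID AS TYPED, a record-side window numeral is the plan's); no inhabitant of the record ∕ admissible tuple at the datum of record is claimed (K0 OPEN); N22 NOT discharged
(typed 28∕28 · discharged 5∕27 UNCHANGED); NE9 NOT IN PRINT for d = 4; one finite four-torus programme at fixed ε — NOT infinite volume, NOT OS on ℝ⁴, NOT a mass gap, NOT Clay.
0 `sorry`, 0 `def`, standard axioms.

References (TYPES only): [II] = [Balaban1988RG2Cluster] (1.5) p. 3, Lemma 1 (1.33)–(1.36) p. 9, (1.38)–(1.39) p. 10, Lemma 2 (1.41)–(1.43) p. 11, (2.2)–(2.3) p. 12, p. 13,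
(2.14)–(2.26) pp. 15–17; [I] = [Balaban1987RG1] §1 p. 263, (2.6)–(2.13) pp. 266–268; [Balaban1985BackgroundPropagators] Thm 3.10 p. 416.
-/

noncomputable section

namespace YMDAG.N22.W1

open Set Metric Matrix
open scoped BigOperators
open Literature.MathematicalPhysics.QuantumFieldTheory.Balaban1983to89
open Literature.MathematicalPhysics.QuantumFieldTheory.Balaban1983to89.TreeLengthTorus (TPt TDom tsys torusTreeLen torusTreeLen_nonneg)
open Literature.MathematicalPhysics.QuantumFieldTheory.Balaban1983to89.B13Bound143 (invTau)
open Literature.MathematicalPhysics.QuantumFieldTheory.Balaban1983to89.B9Thm37GlueTorus (tdist1)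
open Literature.MathematicalPhysics.QuantumFieldTheory.Balaban1983to89.B5TorusCover (UT)
open Literature.MathematicalPhysics.QuantumFieldTheory.Balaban1983to89.Step (SFConsts)
open Literature.MathematicalPhysics.QuantumFieldTheory.Balaban1983to89.Node00.Sect2 (domSys domCount CPair spaceI domSites Setting Residual)
open Literature.MathematicalPhysics.QuantumFieldTheory.Balaban1983to89.Node00.W1
open Literature.MathematicalPhysics.QuantumFieldTheory.Balaban1983to89.B13Term214 (term214 core214 F214)
open Literature.MathematicalPhysics.QuantumFieldTheory.Balaban1983to89.B12TreeDecay (kappa₀)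
open Literature.MathematicalPhysics.QuantumFieldTheory.Balaban1983to89.B13ExpansionOrder (BeginsAt)
open Literature.MathematicalPhysics.QuantumFieldTheory.Balaban1983to89.B13Lemma2LeadingParts (ofRealVec)
open Literature.MathematicalPhysics.QuantumFieldTheory.Balaban1983to89.B13TermWalkData (WalkConsts TermKernels TermWalkData)
open Summit.QuantumFields.YangMills.BalabanUVNodes

namespace SliceInputsL2U

variable {c : B13.Consts} {P : Params} {𝔸 : Type*} [NormedRing 𝔸] [NormedAlgebra ℂ 𝔸] [CompleteSpace 𝔸] {M k L : ℕ} [NeZero L] (𝔇 : TermDatum214 c P 𝔸 M k L)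
  (χu χcu : (Z : (domSys P M (k + 1)).Dom) → (t : TermLabel P M k L) → ((𝔇.𝒦 Z t).Λ → ℝ) → ℝ)
  {G : Type*} [GaugeGroup G] (Sg : Setting 𝔸 G) (Rz : Residual P 𝔸) (cs : SFConsts) (E₀ κE : ℝ)
  (Z : (domSys P M (k + 1)).Dom) (t : TermLabel P M k L) (W : Set (CPair P 𝔸)) (s₀ a a₅ ρb Mv : ℝ)

/-- **★ THE LOCATED RECORD OF ONE SLICE ASSEMBLED FROM THE LANDED BLOCK PRODUCERS' INPUTS** — `Nonempty (SliceInputsL2U 𝔇 χᵘ χᶜᵘ (realSliceWilson Wc) (realSliceOlder Oc) c Sg Rz cs E₀ κ_E Z t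
W s₀ a a₅ ρ_b Mv)` for the window-dilated members of base point `s₀ > 0` of the term `(Z, t)` on an OPEN thickening `W`, FROM: (T) W1-8's `0 < τ(d) ≤ ½`, the Cauchy radius
`0 < r ≤ e^{κ₁} − 1`, τ-radii `R Y ≥ τ(Y)⁻¹ + r + 2` on `𝐃`; (K) NODE A's walk record at the slice re-keyed at `c⁺` with an admissible package, the reading map holomorphic on `W` into the
`α`-ball, symmetry ∕ `Re ≻ 0` of the precision on the closed `e^{κ₁+1}`-polydisc, rates `kap'' < kap' < κ_b < κ_a < w.kap`, kernel letters dominating the package's (module J16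
`SliceInputsLGU.kernelLaws_of_termWalkData` supplies `hAd hGd hAs hA hG hΓ₀ hCs hC216 hdΓ hdC hdE` at `Uσ := ball 0 e^{κ₁+1}`); (O) σ-holomorphy of the kernels on that polydisc at every
`ξ ∈ W` (NODE O), the fibre count, the `C⁻¹` letter, the primed letters and `θ` verbatim, `0 ≤ ρ_b < 1`; (B) print's boxes on the row bonds with node00-def-B13's count pin and threshold
`ε₁ > 0` (dag-n22-w1's `unscaledBoxLaws_of_printedBoxes ∕ h222_atDatum ∕ hqP_atDatum ∕ hχ1_atDatum ∕ hboxR_atDatum ∕ hbox_atDatum` supply the six box laws at `s₀`, (2.22) at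
`qP := Σ_{Pl} B²`, `rP := ε₁∕s₀`, the guarded `χχᶜ ≤ 1`, the box law at `Rb := ε₁∕s₀`, the support law at `ρ := ε₁`, `S₀ := Y0l`), the letters `γ₂ T TP κ r₁` with their nine window
clauses verbatim; (N) the mixed numerals verbatim at `kap := κ_b`; (W) a complex Wilson remainder `Wc` on `ball 0 RA ∋` the box (`ε₁ < RA`) with Lemma 2's three clauses and the real slice's
measurability ∕ configuration law ∕ `Y`-locality — all eight Wilson fields supplied by dag-n22-w3's `wilsonBlock_of_wilsonOfActionOn` from ONE analytic localized action `𝒜` with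
`WilsonOfActionOn Wc Z t 𝒜 W 𝔅c`, joint analyticity, sup letter `M𝒜` (`M𝒲 ≥ wilsonSupBound M𝒜`), real-slice measurability, locality — supports `S Y` located in `Y` and inside `Y0l`, the
(2.19) profile; (L) one complex
reading of the older terms with module J20 §2's hypotheses verbatim (`olderBlock_of_readsOnByC` supplies all eight older fields at `M𝒪 ≥ crudeBound`); (C) the closures verbatim at
`ρ := ε₁`.  Proof: the four producers BY NAME, W1-12's base-point faces `nonneg_smul ∕ even_smul ∕ measurable_smul`, relettering by monotonicity, the (2.19) regions
`Uτ Y := ball 0 (τ(Y)⁻¹ + r + 2)` by the triangle inequality, and the anonymous constructor.  Bookkeeping; no estimate proved here.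
[cite: Balaban1988RG2Cluster, (1.5) p.3, Lemma 1 (1.33)-(1.36) p.9, (1.38)-(1.39) p.10, Lemma 2 (1.41)-(1.43) p.11, (2.2)-(2.3) p.12, p.13, (2.14)-(2.26) pp.15-17; Balaban1987RG1, §1 p.263, (2.6)-(2.13) pp.266-268; Balaban1985BackgroundPropagators, Thm 3.10 p.416] -/
theorem nonempty_of_blocks
    -- ═════════ THE THICKENING and the τ-letters of the constants (W1-8's elementary conditions on `c`; the datum's Cauchy radius against `κ₁`) ═════════
    (hW : IsOpen W) (hinv : ∀ d : ℝ, 0 ≤ d → 0 < invTau c d ∧ invTau c d ≤ 1 / 2) (hr : 0 < 𝔇.r) (hr' : 𝔇.r ≤ Real.exp c.κ₁ - 1)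
    -- the τ-radii bound the (2.19) regions `|τ| < τ(Y)⁻¹ + r + 2` on `𝐃` (the letter `R Y` of the profile and of the closures)
    (R : TDom P.d (L * domCount P M (k + 1)) → ℝ) (hRτ : ∀ Y ∈ t.1, (invTau c ((tsys P.d (L * domCount P M (k + 1))).dj Y))⁻¹ + 𝔇.r + 2 ≤ R Y)
    -- ═════════ THE KERNEL BLOCK — NODE A's WALK RECORD at the slice, re-keyed at `c⁺` (module J16's inputs VERBATIM), the reading map into the `α`-ball, symmetry ∕ `Re ≻ 0` of the precision ═════════
    {w : WalkConsts} {α Rσ₀ : ℝ} (hw : w.Admissible α Rσ₀) (hα : 0 < α)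
    (h𝒦 : TermWalkData ({ (𝔇.𝒦 Z t) with } : TermKernels ({ c with κ₁ := c.κ₁ + 1 } : B13.Consts) P.d (domCount P M (k + 1)) 𝔇.ν 𝔇.Nf 𝔇.E₃) w)
    (huOf : DifferentiableOn ℂ (𝔇.uOf Z t) W) (humaps : MapsTo (𝔇.uOf Z t) W (ball (0 : 𝔇.E₃) α))
    (hAsym : ∀ ξ ∈ W, ∀ σ : TPt P.d (domCount P M (k + 1)) → ℂ, (∀ j, ‖σ j‖ ≤ Real.exp (c.κ₁ + 1)) → (𝔇.A Z t ξ σ).IsSymm)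
    (hApos : ∀ ξ ∈ W, ∀ σ : TPt P.d (domCount P M (k + 1)) → ℂ, (∀ j, ‖σ j‖ ≤ Real.exp (c.κ₁ + 1)) → ((𝔇.A Z t ξ σ).map Complex.re).PosDef)
    -- the record's three rates: `kap := κb < κa < w.kap` (J16's drop), `kap'' < kap' < κb`
    {κa κb kap' kap'' : ℝ} (hκa : κa < w.kap) (hκb : κb < κa)
    (hkap'' : 0 < kap'')
    (hk1 : kap'' < kap')
    (hk2 : kap' < κb)
    -- the kernel letters of the record DOMINATE the package's (relettering; J16's letters are `K̄_Γ, K̄_Γ, K̄_C, K̄_C` and the three explicit σ-difference sizes)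
    {KG KΓ KCs K₀ KE θΓ θC θE KG' KCs' θΓ' θC' θE' θ : ℝ}
    (hKGw : w.KbarΓ ≤ KG) (hKΓw : w.KbarΓ ≤ KΓ) (hKCsw : w.KbarC ≤ KCs) (hK₀w : w.KbarC ≤ K₀)
    (hθΓw : 2 * w.KbarΓ * Real.exp (-(w.ε * w.Rσ)) + 2 * w.KbarΓ * α / w.R ≤ θΓ)
    (hθCw : w.KbarC * (2 * w.KbarE * Real.exp (-(w.ε * w.Rσ)) + 2 * w.KbarE * α / w.R)
        * ((𝔇.𝒦 Z t).m * (1 + 2 / (w.kap - κa)) ^ 𝔇.ν) * w.KbarC * ((𝔇.𝒦 Z t).m * (1 + 2 / (κa - κb)) ^ 𝔇.ν) ≤ θC)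
    (hθEw : 2 * w.KbarE * Real.exp (-(w.ε * w.Rσ)) + 2 * w.KbarE * α / w.R ≤ θE)
    -- the `C⁻¹` letter, the fibre count of the site locations, σ-HOLOMORPHY on the open `e^{κ₁+1}`-polydisc (NODE O), the primed letters and the perturbation size `θ` (VERBATIM), `0 ≤ ρ_b < 1`
    (hKE : 0 ≤ KE)
    (hCE : ∀ b b', ‖((𝔇.𝒦 Z t).C⁻¹.map (algebraMap ℝ ℂ)) b b'‖ ≤ KE * Real.exp (-(κb * tdist1 𝔇.Nf ((𝔇.𝒦 Z t).locΛ b) ((𝔇.𝒦 Z t).locΛ b'))))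
    (hfibN : ∀ x : UT 𝔇.Nf, (Finset.univ.filter fun j => (𝔇.𝒦 Z t).locN j = x).card ≤ (𝔇.𝒦 Z t).m)
    (hAhol : ∀ ξ ∈ W, ∀ i j, DifferentiableOn ℂ (fun σ => 𝔇.A Z t ξ σ i j) {σ | ∀ j, σ j ∈ ball (0 : ℂ) (Real.exp (c.κ₁ + 1))})
    (hGhol : ∀ ξ ∈ W, ∀ i j, DifferentiableOn ℂ (fun σ => (𝔇.𝒦 Z t).G2 σ (𝔇.uOf Z t ξ) i j) {σ | ∀ j, σ j ∈ ball (0 : ℂ) (Real.exp (c.κ₁ + 1))})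
    (hKG' : (1 + ρb) * KG ≤ KG')
    (hKCs' : ((1 - ρb) ^ 2)⁻¹ * KCs ≤ KCs')
    (hθΓ' : θΓ + ρb * KG ≤ θΓ')
    (hθC' : θC + ρb * (2 + ρb) * ((1 - ρb) ^ 2)⁻¹ * KCs ≤ θC')
    (hθE' : θE + ρb * (2 + ρb) * (θE + KE) ≤ θE')
    (hθEle : θE' ≤ θ)
    (hθΓle : θΓ' ≤ θ)
    (hθR1le : ((𝔇.𝒦 Z t).m * (1 + 2 / (κb - kap')) ^ 𝔇.ν) * ((𝔇.𝒦 Z t).m * (1 + 2 / (kap' - kap'')) ^ 𝔇.ν) * (θΓ' * KCs' * KG' + KΓ * θC' * KG' + KΓ * K₀ * θΓ') ≤ θ)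
    (hsmallKθ : K₀ * ((𝔇.𝒦 Z t).m * (1 + 2 / κb) ^ 𝔇.ν) * (θ * ((𝔇.𝒦 Z t).m * (1 + 2 / kap'') ^ 𝔇.ν)) < 1)
    (hρb0 : 0 ≤ ρb) (hρb1 : ρb < 1)
    -- ═════════ THE BOX BLOCK — PRINT'S BOXES on the term's row bonds (dag-n22-w1's at-datum inputs VERBATIM: the `Y₀`-bonds `Y0l`, the `P`-bonds `Pl` with node00-def-B13's count pin, threshold `ε₁`), base point `s₀ > 0`;
    -- the (2.22) letter `γ₂`, the tail letters `T, TP`, the box-tail rate `κ` and the large-field radius `r₁` against the knit's `a, Mv` at `rP = Rb = ε₁∕s₀` (the window numerals of dag-n22-w1 ∕ w2, displayed) ═════════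
    (Y0l Pl : (Z : (domSys P M (k + 1)).Dom) → (t : TermLabel P M k L) → Finset (𝔇.𝒦 Z t).Λ) {ε₁ : ℝ} (hε₁ : 0 < ε₁) (hs₀ : 0 < s₀)
    (hχu : ∀ Z t A, χu Z t A = ∏ b ∈ Y0l Z t, (if |A b| < ε₁ then (1 : ℝ) else 0))
    (hχcu : ∀ Z t A, χcu Z t A = ∏ b ∈ Pl Z t, (if ε₁ ≤ |A b| then (1 : ℝ) else 0)) (hPcard : (Pl Z t).card = t.2.card)
    {γ₂ T TP κ r₁ : ℝ}
    (hγ₂ : 0 ≤ γ₂)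
    (hκ : 0 ≤ κ)
    (hPa : a ≤ γ₂ * (ε₁ / s₀) ^ 2)
    (hr₁ : t.2 ≠ ∅ → r₁ ^ 2 ≤ (ε₁ / s₀) ^ 2)
    (hPa1 : t.2 ≠ ∅ → a ≤ γ₂ * r₁ ^ 2)
    (hRb : t.2 = ∅ → Real.exp (-(κ / 2 * (ε₁ / s₀) ^ 2)) ≤ T * s₀ ^ 2)
    (hTP : t.2 ≠ ∅ → Real.exp (-(γ₂ / 2 * ((ε₁ / s₀) ^ 2 - r₁ ^ 2))) ≤ TP * s₀ ^ 2)
    (hMvT : t.2 = ∅ → 1 + T ≤ Mv)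
    (hMvP : t.2 ≠ ∅ → TP ≤ Mv)
    -- ═════════ THE MIXED NUMERALS (kernel smallness against the covariance, the (2.22) and quadratic rates, the volume bounds at rate `a₅`; VERBATIM at `kap := κb`) ═════════
    {cE g a' w' ac wc a₀ w₀ α₀ : ℝ}
    (hc0 : 0 ≤ cE)
    (hc : ∀ i, (𝔇.𝒦 Z t).hC.1.eigenvalues i ≤ cE)
    (hαc : (2 * (θ * ((𝔇.𝒦 Z t).m * (1 + 2 / kap'') ^ 𝔇.ν)) + (γ₂ + a')) * cE ≤ 1 / 2)
    (hg : 0 ≤ g)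
    (hΓq : ∀ X : (𝔇.𝒦 Z t).Λ ⊕ (𝔇.𝒦 Z t).C₀ → ℝ, ((𝔇.𝒦 Z t).Γ₀ *ᵥ X) ⬝ᵥ ((𝔇.𝒦 Z t).C *ᵥ ((𝔇.𝒦 Z t).Γ₀ *ᵥ X)) ≤ g * (X ⬝ᵥ X))
    (hsmall : (2 * (θ * ((𝔇.𝒦 Z t).m * (1 + 2 / kap'') ^ 𝔇.ν)) + (γ₂ + a')) * (1 + 2 * cE * g) ≤ 1 / 2)
    (hvol : 2 * (K₀ * ((𝔇.𝒦 Z t).m * (1 + 2 / κb) ^ 𝔇.ν) * (θ * ((𝔇.𝒦 Z t).m * (1 + 2 / kap'') ^ 𝔇.ν)) * (1 + (1 - K₀ * ((𝔇.𝒦 Z t).m * (1 + 2 / κb) ^ 𝔇.ν) * (θ * ((𝔇.𝒦 Z t).m * (1 + 2 / kap'') ^ 𝔇.ν)))⁻¹) / 2) * (Fintype.card (𝔇.𝒦 Z t).Λ : ℝ) + w' + (2 * (θ * ((𝔇.𝒦 Z t).m * (1 + 2 / kap'') ^ 𝔇.ν)) + (γ₂ + a')) * cE * (Fintype.card (𝔇.𝒦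 Z t).Λ : ℝ) + (2 * (θ * ((𝔇.𝒦 Z t).m * (1 + 2 / kap'') ^ 𝔇.ν)) + (γ₂ + a')) * (1 + 2 * cE * g) * (Fintype.card ((𝔇.𝒦 Z t).Λ ⊕ (𝔇.𝒦 Z t).C₀) : ℝ) ≤ a₅ * ((Z.1).card : ℝ))
    (hαc_c : (2 * (θ * ((𝔇.𝒦 Z t).m * (1 + 2 / kap'') ^ 𝔇.ν)) + (γ₂ + ac)) * cE ≤ 1 / 2)
    (hsmall_c : (2 * (θ * ((𝔇.𝒦 Z t).m * (1 + 2 / kap'') ^ 𝔇.ν)) + (γ₂ + ac)) * (1 + 2 * cE * g) ≤ 1 / 2)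
    (hvol_c : 2 * (K₀ * ((𝔇.𝒦 Z t).m * (1 + 2 / κb) ^ 𝔇.ν) * (θ * ((𝔇.𝒦 Z t).m * (1 + 2 / kap'') ^ 𝔇.ν)) * (1 + (1 - K₀ * ((𝔇.𝒦 Z t).m * (1 + 2 / κb) ^ 𝔇.ν) * (θ * ((𝔇.𝒦 Z t).m * (1 + 2 / kap'') ^ 𝔇.ν)))⁻¹) / 2) * (Fintype.card (𝔇.𝒦 Z t).Λ : ℝ) + wc + (2 * (θ * ((𝔇.𝒦 Z t).m * (1 + 2 / kap'') ^ 𝔇.ν)) + (γ₂ + ac)) * cE * (Fintype.card (𝔇.𝒦 Z t).Λ : ℝ) + (2 * (θ * ((𝔇.𝒦 Z t).m * (1 + 2 / kap'') ^ 𝔇.ν)) + (γ₂ + ac)) * (1 + 2 * cE * g) * (Fintype.card ((𝔇.𝒦 Z t).Λ ⊕ (𝔇.𝒦 Z t).C₀) : ℝ) ≤ a₅ * ((Z.1).card : ℝ))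
    (ha₀ : 0 ≤ a₀)
    (hαc_b : (2 * (θ * ((𝔇.𝒦 Z t).m * (1 + 2 / kap'') ^ 𝔇.ν)) + (κ + a₀)) * cE ≤ 1 / 2)
    (hsmall_b : (2 * (θ * ((𝔇.𝒦 Z t).m * (1 + 2 / kap'') ^ 𝔇.ν)) + (κ + a₀)) * (1 + 2 * cE * g) ≤ 1 / 2)
    (hvol_b : 2 * (K₀ * ((𝔇.𝒦 Z t).m * (1 + 2 / κb) ^ 𝔇.ν) * (θ * ((𝔇.𝒦 Z t).m * (1 + 2 / kap'') ^ 𝔇.ν)) * (1 + (1 - K₀ * ((𝔇.𝒦 Z t).m * (1 + 2 / κb) ^ 𝔇.ν) * (θ * ((𝔇.𝒦 Z t).m * (1 + 2 / kap'') ^ 𝔇.ν)))⁻¹) / 2) * (Fintype.card (𝔇.𝒦 Z t).Λ : ℝ) + w₀ + (2 * (θ * ((𝔇.𝒦 Z t).m * (1 + 2 / kap'') ^ 𝔇.ν)) + (κ + a₀)) * cE * (Fintype.card (𝔇.𝒦 Z t).Λ : ℝ) + (2 * (θ * ((𝔇.𝒦 Z t).m * (1 + 2 / kap'') ^ 𝔇.ν))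 + (κ + a₀)) * (1 + 2 * cE * g) * (Fintype.card ((𝔇.𝒦 Z t).Λ ⊕ (𝔇.𝒦 Z t).C₀) : ℝ) ≤ a₅ * ((Z.1).card : ℝ))
    (hα₀ : 0 ≤ α₀)
    (hαc_f : (2 * (θ * ((𝔇.𝒦 Z t).m * (1 + 2 / kap'') ^ 𝔇.ν)) + α₀) * cE ≤ 1 / 2)
    (hsmall_f : (2 * (θ * ((𝔇.𝒦 Z t).m * (1 + 2 / kap'') ^ 𝔇.ν)) + α₀) * (1 + 2 * cE * g) ≤ 1 / 2)
    (hαc_0 : (2 * (θ * ((𝔇.𝒦 Z t).m * (1 + 2 / kap'') ^ 𝔇.ν)) + (γ₂ + a₀)) * cE ≤ 1 / 2)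
    (hsmall_0 : (2 * (θ * ((𝔇.𝒦 Z t).m * (1 + 2 / kap'') ^ 𝔇.ν)) + (γ₂ + a₀)) * (1 + 2 * cE * g) ≤ 1 / 2)
    (hvol_0 : 2 * (K₀ * ((𝔇.𝒦 Z t).m * (1 + 2 / κb) ^ 𝔇.ν) * (θ * ((𝔇.𝒦 Z t).m * (1 + 2 / kap'') ^ 𝔇.ν)) * (1 + (1 - K₀ * ((𝔇.𝒦 Z t).m * (1 + 2 / κb) ^ 𝔇.ν) * (θ * ((𝔇.𝒦 Z t).m * (1 + 2 / kap'') ^ 𝔇.ν)))⁻¹) / 2) * (Fintype.card (𝔇.𝒦 Z t).Λ : ℝ) + w₀ + (2 * (θ * ((𝔇.𝒦 Z t).m * (1 + 2 / kap'') ^ 𝔇.ν)) + (γ₂ + a₀)) * cE * (Fintype.card (𝔇.𝒦 Z t).Λ : ℝ) + (2 * (θ * ((𝔇.𝒦 Z t).m * (1 + 2 / kap'') ^ 𝔇.ν)) + (γ₂ + a₀)) * (1 + 2 * cE * g) * (Fintype.card ((𝔇.𝒦 Z t).Λ ⊕ (𝔇.𝒦 Z t).C₀) : ℝ) ≤ a₅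 * ((Z.1).card : ℝ))
    -- ═════════ THE WILSON BLOCK — ONE ANALYTIC LOCALIZED ACTION READING (dag-n22-w3's J22 `wilsonBlock_of_wilsonOfActionOn` inputs VERBATIM, on node00-def-W1's W1-17d `LocActionC ∕ WilsonOfActionOn`):
    -- the complex Wilson remainder `Wc` IS the third-order remainder of `𝒜` on `W × 𝔅c` (`𝔅c` open, `⊇ ball 0 RA ∋` the box: `ε₁ < RA`, containing every real field), `𝒜` jointly analytic, sup letter `M𝒜`,
    -- real-slice measurable, local through the supports `S Y ⊆ Y0l` located in `Y`; letter `M𝒲 ≥ wilsonSupBound M𝒜 = 8·M𝒜`; profile letters `Cp κp` and the (2.19) profile at the τ-radii; box radius `ρ := ε₁`, `S₀ := Y0l Z t` ═════════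
    (Wc : 𝔇.ComplexWilson) (𝒜 : 𝔇.LocActionC Z t) {𝔅c : Set ((𝔇.𝒦 Z t).Λ → ℂ)} {RA : ℝ} (hε₁RA : ε₁ < RA)
    (hWA : 𝔇.WilsonOfActionOn Wc Z t 𝒜 W 𝔅c) (h𝔅o : IsOpen 𝔅c) (h𝔅 : ball 0 RA ⊆ 𝔅c) (h𝔅r : ∀ A : (𝔇.𝒦 Z t).Λ → ℝ, ofRealVec A ∈ 𝔅c) (hAj : 𝒜.JointHoloOn W 𝔅c)
    {M𝒜 : TDom P.d (L * domCount P M (k + 1)) → ℝ} (hAM : 𝒜.SupBoundOn W RA M𝒜) (hM𝒜 : ∀ Y ∈ t.1, 0 ≤ M𝒜 Y) (hAm : 𝒜.RealSliceMeasurable W)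
    (S : TDom P.d (L * domCount P M (k + 1)) → Finset (𝔇.𝒦 Z t).Λ) (hAloc : 𝒜.LocalInC W S) (cubeOf : (𝔇.𝒦 Z t).Λ → TPt P.d (L * domCount P M (k + 1)))
    (M𝒲 : TDom P.d (L * domCount P M (k + 1)) → ℝ) (hM𝒲c : ∀ Y, TermDatum214.wilsonSupBound M𝒜 Y ≤ M𝒲 Y) {Cp κp : ℝ}
    (hS : ∀ Y ∈ t.1, ∀ b ∈ S Y, cubeOf b ∈ Y.1)
    (hCp : 0 ≤ Cp)
    (hκp : kappa₀ (4 * 2 ^ P.d) (2 * P.d) ≤ κp)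
    (hSS₀ : ∀ Y ∈ t.1, ∀ b ∈ S Y, b ∈ Y0l Z t)
    (hdecay : ∀ Y ∈ t.1, R Y * (M𝒲 Y / RA ^ 3) ≤ Cp * Real.exp (-κp * (tsys P.d (L * domCount P M (k + 1))).dj Y))
    -- ═════════ THE OLDER-TERMS BLOCK — ONE COMPLEX READING on the admissible class, the thickening and every complex field (module J20 §2's inputs VERBATIM; letter `M𝒪 ≥ crudeBound`) ═════════
    (Oc : 𝔇.ComplexOlder) {Sa : Type*} [MeasurableSpace Sa] [TopologicalSpace Sa] [OpensMeasurableSpace Sa] {Ra : 𝔇.ReadingAtomsC Z t Sa} {C mu : ℝ}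
    {m : TDom P.d (L * domCount P M (k + 1)) → (j : Fin (k + 1)) → (domSys P M j).Dom → ℝ}
    (hread : 𝔇.ReadsOnByC Oc Z t Ra (AdmHist (spaceOfRecord (M := M) Sg Rz (fun _ => cs.α₀) (fun _ => cs.α₁)) E₀ κE k) W univ)
    (hRmaps : Ra.MapsToTablesC (fun j X => spaceI Sg Rz M j (domSites P M j X) cs.α₀ cs.α₁) W univ) (hRholξ : Ra.CfgCHoloOn W univ) (hRhol : Ra.CfgFieldHoloOn W univ)
    (hRjc : Ra.CfgCJointContinuous) (hC : 0 ≤ C) (hE₀ : 0 ≤ E₀) (hRK : Ra.KernelBounded C) (hRμ : Ra.FiniteMass mu) (hm : ∀ Y j X, 0 ≤ m Y j X) (hRμm : Ra.FiniteMassAt m)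
    (hRloc : Ra.LocalInC ((Y0l Z t : Finset (𝔇.𝒦 Z t).Λ) : Set (𝔇.𝒦 Z t).Λ))
    (M𝒪 : TDom P.d (L * domCount P M (k + 1)) → ℝ) (hM𝒪c : ∀ Y, TermDatum214.crudeBound C E₀ κE m Y ≤ M𝒪 Y)
    -- ═════════ THE CLOSURES (slice letters `a′ w′ a_c w_c w₀`, centred split `δ`; VERBATIM at `ρ := ε₁`) ═════════
    {δ : ℝ}
    (hδ : 0 < δ)
    (ha' : (1 + ρb) ^ 2 * (2 * ε₁ * (Cp * B12TreeDecay.K₀ (4 * 2 ^ P.d) (2 * P.d))) ≤ a')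
    (hw' : (1 + ρb) ^ 2 * (∑ Y ∈ t.1, R Y * (M𝒪 Y + (2 * M𝒪 Y / RA) * ε₁)) ≤ w')
    (hac : 2 * δ + 8 * ε₁ * (Cp * B12TreeDecay.K₀ (4 * 2 ^ P.d) (2 * P.d)) ≤ ac)
    (hwc : Real.exp (∑ Y ∈ t.1, R Y * M𝒪 Y) * ((∑ Y ∈ t.1, R Y * ((4 * (2 * M𝒲 Y / RA ^ 4) + (4 * (M𝒲 Y / RA ^ 3) + 4 * (M𝒲 Y / RA ^ 3)) / ε₁) * (4 / (Real.exp 1 * δ)) ^ 4 + ((4 * M𝒪 Y / RA ^ 2) + ((2 * M𝒪 Y / RA) + (2 * M𝒪 Y / RA)) / ε₁) * (2 / (Real.exp 1 * δ)) ^ 2)) * Real.exp (δ / 2) + ((∑ Y ∈ t.1, R Y * (4 * (M𝒲 Y / RA ^ 3) * (3 / (Real.exp 1 * δ)) ^ 3 + (2 * M𝒪 Y / RA) * (1 / (Real.exp 1 * δ)))) * Real.exp (δ / 2)) ^ 2 * Real.exp ((∑ Y ∈ t.1, R Y * (M𝒪 Y + (2 * M𝒪 Y / RA) * ε₁)) +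 ∑ Y ∈ t.1, R Y * M𝒪 Y)) ≤ Real.exp wc)
    (hw₀ : ∑ Y ∈ t.1, R Y * M𝒪 Y ≤ w₀)
    : Nonempty (SliceInputsL2U 𝔇 χu χcu (𝔇.realSliceWilson Wc) (𝔇.realSliceOlder Oc) c Sg Rz cs E₀ κE Z t W s₀ a a₅ ρb Mv) := by
  -- (T) W1-8's τ-letters and the (2.19) regions `Uτ Y := ball 0 (τ(Y)⁻¹ + r + 2)`
  have hposY : ∀ Y : TDom P.d (L * domCount P M (k + 1)), 0 < invTau c ((tsys P.d (L * domCount P M (k + 1))).dj Y) := fun Y =>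
    (hinv _ (torusTreeLen_nonneg Y.1)).1
  have hhalfY : ∀ Y : TDom P.d (L * domCount P M (k + 1)), invTau c ((tsys P.d (L * domCount P M (k + 1))).dj Y) ≤ 1 / 2 := fun Y =>
    (hinv _ (torusTreeLen_nonneg Y.1)).2
  have hUtau : ∀ Y : TDom P.d (L * domCount P M (k + 1)), closedBall (0 : ℂ) ((invTau c ((tsys P.d (L * domCount P M (k + 1))).dj Y))⁻¹) ⊆
      ball (0 : ℂ) ((invTau c ((tsys P.d (L * domCount P M (k + 1))).dj Y))⁻¹ + 𝔇.r + 2) := fun Y =>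
    closedBall_subset_ball (by linarith only [hr])
  have hsubτ : ∀ Y : TDom P.d (L * domCount P M (k + 1)), ∀ x ∈ Set.uIcc (0 : ℝ) 1,
      closedBall (x : ℂ) 𝔇.r ⊆ ball (0 : ℂ) ((invTau c ((tsys P.d (L * domCount P M (k + 1))).dj Y))⁻¹ + 𝔇.r + 2) := by
    intro Y x hx z hz
    have hx1 : ‖(x : ℂ)‖ ≤ 1 := by
      rw [Complex.norm_real, Real.norm_eq_abs, abs_le]
      rcases Set.mem_uIcc.1 hx with h | h <;> constructor <;> linarith only [h.1, h.2]
    have hτ := inv_pos.2 (hposY Y)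
    rw [mem_closedBall, dist_eq_norm] at hz
    rw [mem_ball_zero_iff]
    calc ‖z‖ = ‖(z - (x : ℂ)) + (x : ℂ)‖ := by rw [sub_add_cancel]
      _ ≤ ‖z - (x : ℂ)‖ + ‖(x : ℂ)‖ := norm_add_le _ _
      _ ≤ 𝔇.r + 1 := add_le_add hz hx1
      _ < _ := by linarith only [hτ]
  have hR0 : ∀ Y ∈ t.1, 0 ≤ R Y := fun Y hY =>
    le_trans (by linarith only [inv_pos.2 (hposY Y), hr]) (hRτ Y hY)
  have hUτR : ∀ Y ∈ t.1, ∀ z ∈ ball (0 : ℂ) ((invTau c ((tsys P.d (L * domCount P M (k + 1))).dj Y))⁻¹ + 𝔇.r + 2), ‖z‖ ≤ R Y :=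
    fun Y hY z hz => (mem_ball_zero_iff.1 hz).le.trans (hRτ Y hY)
  -- (K) the kernel block BY NAME (module J16) at `Uσ := ball 0 e^{κ₁+1}`, relettered by monotonicity
  have hκb0 : 0 < κb := hkap''.trans (hk1.trans hk2)
  obtain ⟨-, hUexp, hAd, hGd, hAs, hA, hG', hΓ₀', hCs', hC216', hdΓ', hdC', hdE'⟩ :=
    SliceInputsLGU.kernelLaws_of_termWalkData 𝔇 Z t hw hα h𝒦 huOf humaps hAsym hApos hκa hκb hκb0.le
  have hmono : ∀ {x K K' e : ℝ}, x ≤ K * Real.exp e → K ≤ K' → x ≤ K' * Real.exp e :=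
    fun h hK => h.trans (mul_le_mul_of_nonneg_right hK (Real.exp_nonneg _))
  have hG := fun ξ hξ σ hσ b j => hmono (hG' ξ hξ σ hσ b j) hKGw
  have hΓ₀ := fun b j => hmono (hΓ₀' b j) hKΓw
  have hCs := fun ξ hξ σ hσ b b' => hmono (hCs' ξ hξ σ hσ b b') hKCsw
  have hC216 := fun b b' => hmono (hC216' b b') hK₀w
  have hdΓ := fun ξ hξ σ hσ b j => hmono (hdΓ' ξ hξ σ hσ b j) hθΓw
  have hdC := fun ξ hξ σ hσ b b' => hmono (hdC' ξ hξ σ hσ b b') hθCw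
  have hdE := fun ξ hξ σ hσ b b' => hmono (hdE' ξ hξ σ hσ b b') hθEw
  have hRw : 0 < w.R := hα.trans hw.hαR
  have hKbΓ := hw.hKbarΓ
  have hKbE := hw.hKbarE
  have hKbC := hw.hKbarC
  have hKG0 : 0 ≤ KG := hKbΓ.trans hKGw
  have hKΓ0 : 0 ≤ KΓ := hKbΓ.trans hKΓw
  have hKCs0 : 0 ≤ KCs := hKbC.trans hKCsw
  have hK₀0 : 0 ≤ K₀ := hKbC.trans hK₀w
  have hθΓ0 : 0 ≤ θΓ := le_trans (by positivity) hθΓw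
  have hθE0 : 0 ≤ θE := le_trans (by positivity) hθEw
  have hθC0 : 0 ≤ θC := by
    have h1 := sub_pos.2 hκa
    have h2 := sub_pos.2 hκb
    exact le_trans (by positivity) hθCw
  -- the unprimed θ-dominations from the primed ones (monotonicity in `ρ_b ∈ [0, 1[`)
  have hKG1 : KG ≤ KG' := (le_mul_of_one_le_left hKG0 (by linarith only [hρb0])).trans hKG'
  have hθΓ1 : θΓ ≤ θΓ' := (le_add_of_nonneg_right (mul_nonneg hρb0 hKG0)).trans hθΓ'
  have hρ2 : 0 < (1 - ρb) ^ 2 := pow_pos (sub_pos.2 hρb1) 2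
  have hKCs1 : KCs ≤ KCs' := by
    have h2 : 1 ≤ ((1 - ρb) ^ 2)⁻¹ := (one_le_inv₀ hρ2).2 (pow_le_one₀ (sub_nonneg.2 hρb1.le) (sub_le_self 1 hρb0))
    exact (le_mul_of_one_le_left hKCs0 h2).trans hKCs'
  have hθC1 : θC ≤ θC' := (le_add_of_nonneg_right (by positivity)).trans hθC'
  have hθE1 : θE ≤ θE' := (le_add_of_nonneg_right (by positivity)).trans hθE'
  have hθEle0 : θE ≤ θ := hθE1.trans hθEle
  have hθΓle0 : θΓ ≤ θ := hθΓ1.trans hθΓle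
  have hKG'0 : 0 ≤ KG' := hKG0.trans hKG1
  have hKCs'0 : 0 ≤ KCs' := hKCs0.trans hKCs1
  have hθΓ'0 : 0 ≤ θΓ' := hθΓ0.trans hθΓ1
  have hθC'0 : 0 ≤ θC' := hθC0.trans hθC1
  have hθR1le0 : ((𝔇.𝒦 Z t).m * (1 + 2 / (κb - kap')) ^ 𝔇.ν) * ((𝔇.𝒦 Z t).m * (1 + 2 / (kap' - kap'')) ^ 𝔇.ν) * (θΓ * KCs * KG + KΓ * θC * KG + KΓ * K₀ * θΓ) ≤ θ := by
    have h1 := sub_pos.2 hk2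
    have h2 := sub_pos.2 hk1
    refine le_trans (mul_le_mul_of_nonneg_left ?_ (by positivity)) hθR1le
    gcongr
  -- (B) the box block BY NAME (dag-n22-w1) at print's boxes: W1-12's laws at the base point, (2.22), the guarded `χχᶜ ≤ 1`, the box law, the support law
  have hBL := N22PrintedBoxBlock.unscaledBoxLaws_of_printedBoxes 𝔇 χu χcu Y0l Pl ε₁ hχu hχcu Z t
  have hBL0 := hBL.nonneg_smul s₀
  have hBLe := hBL.even_smul s₀
  have hBLm := hBL.measurable_smul s₀
  have h222 := N22PrintedBoxBlock.h222_atDatum 𝔇 χu χcu Y0l Pl ε₁ hχu hχcu Z t hPcard hs₀ hγ₂ hε₁.le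
  have hχ1 := N22PrintedBoxBlock.hχ1_atDatum 𝔇 χu χcu Y0l Pl ε₁ hχu hχcu Z t s₀
  have hboxR := N22PrintedBoxBlock.hboxR_atDatum 𝔇 χu χcu Y0l Pl ε₁ hχu hχcu Z t hPcard hs₀ (by positivity : 0 ≤ ε₁ / s₀)
    (div_mul_cancel₀ ε₁ hs₀.ne').le
  have hbox := N22PrintedBoxBlock.hbox_atDatum 𝔇 χu Y0l ε₁ hχu Z t (le_refl ε₁)
  -- (L) the older-terms block BY NAME (module J20 §2), relettered at `M𝒪 ≥ crudeBound`
  have hO := olderBlock_of_readsOnByC (RA := RA) Sg Rz cs E₀ κE Z t Oc hread hW hRmaps hRholξ hRhol hRjc hC hE₀ hRK hRμ hm hRμm hRloc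
  have hM𝒪0 : ∀ Y ∈ t.1, 0 ≤ M𝒪 Y := fun Y hY => (hO.1.1 Y hY).trans (hM𝒪c Y)
  have hOM := fun old hold ξ hξ Y z hz => (hO.1.2.2.2 old hold ξ hξ Y z hz).trans (hM𝒪c Y)
  -- (W) the Wilson block BY NAME (dag-n22-w3's J22 on node00-def-W1's W1-17d), relettered at `M𝒲 ≥ wilsonSupBound M𝒜`
  have hWb := wilsonBlock_of_wilsonOfActionOn Z t Wc 𝒜 hWA hW h𝔅o h𝔅 h𝔅r (hε₁.trans hε₁RA) hAj hAM hM𝒜 hAm hAloc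
  have hM𝒲0 : ∀ Y ∈ t.1, 0 ≤ M𝒲 Y := fun Y hY => (hWb.1.1 Y hY).trans (hM𝒲c Y)
  have hWM := fun ξ hξ Y z hz => (hWb.1.2.2.2.1 ξ hξ Y z hz).trans (hM𝒲c Y)
  exact ⟨
    { Uσ := ball (0 : ℂ) (Real.exp (c.κ₁ + 1)), Uτ := fun Y => ball (0 : ℂ) ((invTau c ((tsys P.d (L * domCount P M (k + 1))).dj Y))⁻¹ + 𝔇.r + 2), γ₂ := γ₂, rP := ε₁ / s₀,
      qP := fun B => ∑ b ∈ Pl Z t, B b ^ 2, kap := κb, kap' := kap', kap'' := kap'', θ := θ, θE := θE, θΓ := θΓ, θC := θC, KG := KG, KΓ := KΓ, KCs := KCs, K₀ := K₀, KE := KE,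
      KG' := KG', KCs' := KCs', θΓ' := θΓ', θC' := θC', θE' := θE', a' := a', w' := w', cE := cE, g := g, Rb := ε₁ / s₀, κ := κ, a₀ := a₀, w₀ := w₀, T := T, α₀ := α₀, r₁ := r₁,
      TP := TP, ac := ac, wc := wc, hW := hW, hpos := hposY, hhalf := hhalfY, hUσ := isOpen_ball, hUτ := fun _ => isOpen_ball, hUexp := hUexp, hUtau := hUtau, hr := hr,
      hr' := hr', hsubτ := hsubτ, hχ0 := hBL0.1, hχc0 := hBL0.2, hχm := hBLm.1, hχcm := hBLm.2, h222 := h222, hγ₂ := hγ₂, hqP := N22PrintedBoxBlock.hqP_atDatum 𝔇 Pl Z t,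
      hAhol := hAhol, hGhol := hGhol, hAd := hAd, hGd := hGd, hAs := hAs, hfibN := hfibN, hkap'' := hkap'', hk1 := hk1, hk2 := hk2, hθE := hθE0, hθΓ := hθΓ0, hθC := hθC0,
      hKG := hKG0, hKΓ := hKΓ0, hKCs := hKCs0, hK₀ := hK₀0, hKE := hKE, hG := hG, hΓ₀ := hΓ₀, hCs := hCs, hC216 := hC216, hCE := hCE, hdΓ := hdΓ, hdC := hdC, hdE := hdE,
      hKG' := hKG', hKCs' := hKCs', hθΓ' := hθΓ', hθC' := hθC', hθE' := hθE', hθEle := hθEle, hθΓle := hθΓle, hθR1le := hθR1le, hsmallKθ := hsmallKθ, hc0 := hc0, hc := hc,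
      hαc := hαc, hg := hg, hΓq := hΓq, hsmall := hsmall, hPa := hPa, hvol := hvol, hχe := hBLe.1, hχce := hBLe.2, hαc_c := hαc_c, hsmall_c := hsmall_c, hvol_c := hvol_c,
      hχ1 := hχ1, hκ := hκ, hboxR := hboxR, ha₀ := ha₀, hαc_b := hαc_b, hsmall_b := hsmall_b, hvol_b := hvol_b, hα₀ := hα₀, hαc_f := hαc_f, hsmall_f := hsmall_f, hr₁ := hr₁,
      hPa1 := hPa1, hA := hA, hθEle0 := hθEle0, hθΓle0 := hθΓle0, hθR1le0 := hθR1le0, hαc_0 := hαc_0, hsmall_0 := hsmall_0, hvol_0 := hvol_0, hRb := hRb, hTP := hTP,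
      hMvT := hMvT, hMvP := hMvP, ρ := ε₁, hρ := hε₁, h𝒲m := hWb.2.1, h𝒲d := hWb.2.2.1, R := R, hR := hR0, hUτR := hUτR, S := S, cubeOf := cubeOf, hS := hS, Cp := Cp, κp := κp,
      hCp := hCp, hκp := hκp, S₀ := ((Y0l Z t : Finset (𝔇.𝒦 Z t).Λ) : Set (𝔇.𝒦 Z t).Λ), hbox := hbox, hSS₀ := fun Y hY b hb => Finset.mem_coe.2 (hSS₀ Y hY b hb), Wc := Wc,
      Oc := Oc, RA := RA, hρRA := hε₁RA, M𝒲 := M𝒲, M𝒪 := M𝒪, hM𝒲 := hM𝒲0, hM𝒪 := hM𝒪0, h𝒲re := fun _ _ _ _ => rfl, hWd := hWb.1.2.2.1, hWM := hWM, hWB := hWb.1.2.2.2.2,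
      hlocY𝒲 := hWb.2.2.2, h𝒪re := hO.1.2.1, hOd := hO.1.2.2.1, hOM := hOM, hdecay := hdecay, δ := δ, hδ := hδ, h𝒪m := hO.2.1, h𝒪d := hO.2.2.1, hloc𝒪 := hO.2.2.2.1,
      hOhol := hO.2.2.2.2, ha' := ha', hw' := hw', hac := hac, hwc := hwc, hw₀ := hw₀ }⟩

end SliceInputsL2U

end YMDAG.N22.W1

end
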